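import Literature.NumberTheory.EllipticCurves.IwasawaAlgebraCharacterEvaluation
import Literature.NumberTheory.EllipticCurves.IwasawaAlgebraGeneratorChange
import HarnessLib

/-!
# `charEval` and level-`N` value maps only see `f mod ω_N`; the `p`-ADIC powers `(1+X)^x = binomialSeries ℤ_p x`
# (`x ∈ ℤ_p`) evaluate / act by `u^m` for ANY natural `m ≡ x (mod p^N)` (Washington §7.1, §13.2; Kato Thm. 12.5 (1))

Topic `NumberTheory/EllipticCurves`, namespace `Literature.NumberTheory.EllipticCurves.IwasawaAlgebra` (continues
`IwasawaAlgebraCharacterEvaluation.lean`, seat g30, p781068).  Typed by seat `bsd-cm-prr-ty1` g34 (literature-prover, cell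
bsd-cm) for REPAIR ROW (C6-R) of crux `EllipticUnitValueSevenOfGZK` = stmt-BirchSwinnertonDyer-19945 (pen bsd-cm-plan g37,
D1008/D1009/D1011): the Skolemised Artin field `DualExpValueDatum.art` (one natural exponent for all levels) is un-inhabitable;
the honest object is the `p`-ADIC Artin exponent `κ(𝔟) ∈ ℤ_p` of an admissible twist `𝔟`, with `σ_𝔟 = γ^{κ(𝔟)} ↦ (1+X)^{κ(𝔟)}
:= PowerSeries.binomialSeries ℤ_p κ(𝔟) ∈ Λ`, and STEP 1 of the rational comparison needs exactly: at a level-`N` character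
(`u^{p^N} = 1`), `σ_𝔟` acts on values by `u^m` for any natural lift `m ≡ κ(𝔟) (mod p^N)`.  PROOFS ONLY (8 theorems, general
`p`, any reading `ι`, any `u` with `u^{p^N} = 1`); no definition, no named fact, no instance, no notation.  A separate module
(not an append) because `IwasawaAlgebraCharacterEvaluation.lean` holds the two definitions `amice`/`charEval` (appends to it are
review-lane) and to keep `IwasawaAlgebraGeneratorChange` out of that file's import cone.

## What is here (all `p`)

* `amice_eq_of_omega_dvd_sub`, `charEval_congr_of_omega_dvd_sub`, `val_smul_congr_of_omega_dvd_sub` — `amice`, `charEval`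
  and any value map `val` with `val ((1+X) • m) = u·val m`, `u^{p^N} = 1` only depend on `f ∈ Λ` modulo
  `ω_N = (1+X)^{p^N} − 1` (uniqueness of the Amice residue; `ω_N` kills level-`N` values).
* `omega_dvd_onePlusX_pow_sub_pow_mod`, `amice_onePlusX_pow`, `charEval_onePlusX_pow` — `(1+X)^m ≡ (1+X)^{m mod p^N}`,
  the residue of `(1+X)^m` is the indicator of `m mod p^N`, `charEval ι u N ((1+X)^m) = u^m`.
* ★ `charEval_binomialSeries`, ★ `val_binomialSeries_smul` — for `x ∈ ℤ_p` and ANY `m ∈ ℕ` with `toZModPow N x = m`: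
  `charEval ι u N (binomialSeries ℤ_p x) = u^m` and `val ((binomialSeries ℤ_p x) • y) = u^m · val y` (from the tree's
  congruence `(1+X)^x ≡ (1+X)^m (mod ω_N)`, `exists_binomialSeries_sub_pow_eq`, `IwasawaAlgebraGeneratorChange.lean` l.183–240).

HONEST FRAMING: commutative algebra of `Λ = ℤ_p⟦X⟧`; nothing about elliptic curves, dual exponentials or BSD is asserted
(value maps are HYPOTHESES `val`); no summit statement is touched; 19945 stays OPEN.

## References
* L. C. Washington, *Introduction to Cyclotomic Fields* (1997), §7.1 Thm. 7.1, Prop. 7.2 (division by `ω_N`,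
  `Λ/ω_N ≅ ℤ_p[ℤ/p^N]`); §12.2 (p. 238: `∫ χ dμ`); §13.2 (`γ^x ↦ (1+T)^x` for `x ∈ ℤ_p`). [Washington1997]
* K. Kato, Astérisque 295 (2004), Thm. 12.5 (1) (p. 221) and §13.9 (p. 230): the functionals `Σ_σ χ(σ)σ(y)·per(x)` are
  `Λ`-semilinear. [Kato2004Asterisque]
* Tree: `IwasawaAlgebraCharacterEvaluation.lean` (`amice`, `amice_eq_of_omega_dvd`, `charEval`, `val_onePlusX_pow_smul`,
  `val_omega_mul_smul`), `IwasawaAlgebraGeneratorChange.lean` (`exists_binomialSeries_sub_pow_eq`).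
-/

noncomputable section

namespace Literature.NumberTheory.EllipticCurves.IwasawaAlgebra

variable (p : ℕ) [hp : Fact p.Prime]

/-! ## §1 `amice` and `charEval` only see `f mod ω_N`; natural and `p`-adic powers of `1 + X` -/

/-- The Amice residue only depends on `f` modulo `ω_N`: `ω_N ∣ f − g ⇒ amice f = amice g` (uniqueness).
[cite: Washington1997, §7.1 Prop. 7.2] -/
theorem amice_eq_of_omega_dvd_sub (N : ℕ) {f g : IwasawaAlgebra p}
    (h : ((1 + PowerSeries.X : IwasawaAlgebra p) ^ p ^ N - 1) ∣ f - g) : amice p N f = amice p N g := by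
  refine amice_eq_of_omega_dvd p N g ?_
  have h2 := dvd_sub (omega_dvd_sub_amice p N f) h
  rwa [sub_sub_sub_cancel_left] at h2

/-- `charEval` only depends on `f` modulo `ω_N` (it factors through `Λ/ω_N ≅ ℤ_p[ℤ/p^N]`).
[cite: Washington1997, §7.1 Thm. 7.1] -/
theorem charEval_congr_of_omega_dvd_sub {B : Type*} [CommRing B] (ι : ℤ_[p] →+* B) (u : B) (N : ℕ)
    {f g : IwasawaAlgebra p} (h : ((1 + PowerSeries.X : IwasawaAlgebra p) ^ p ^ N - 1) ∣ f - g) :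
    charEval p ι u N f = charEval p ι u N g := by
  rw [charEval_def, charEval_def, amice_eq_of_omega_dvd_sub p N h]

/-- `ω_N ∣ (1+X)^m − (1+X)^{m mod p^N}`. [cite: Washington1997, §7.1 Thm. 7.1] -/
theorem omega_dvd_onePlusX_pow_sub_pow_mod (N m : ℕ) :
    ((1 + PowerSeries.X : IwasawaAlgebra p) ^ p ^ N - 1) ∣
      (1 + PowerSeries.X : IwasawaAlgebra p) ^ m - (1 + PowerSeries.X : IwasawaAlgebra p) ^ (m % p ^ N) := by
  obtain ⟨q, hq⟩ : ((1 + PowerSeries.X : IwasawaAlgebra p) ^ p ^ N - 1) ∣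
      ((1 + PowerSeries.X : IwasawaAlgebra p) ^ p ^ N) ^ (m / p ^ N) - 1 := by
    simpa only [one_pow] using sub_dvd_pow_sub_pow ((1 + PowerSeries.X : IwasawaAlgebra p) ^ p ^ N) 1 (m / p ^ N)
  refine ⟨(1 + PowerSeries.X : IwasawaAlgebra p) ^ (m % p ^ N) * q, ?_⟩
  have hm : (1 + PowerSeries.X : IwasawaAlgebra p) ^ m =
      (1 + PowerSeries.X : IwasawaAlgebra p) ^ (m % p ^ N) * ((1 + PowerSeries.X : IwasawaAlgebra p) ^ p ^ N) ^ (m / p ^ N) := by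
    rw [← pow_mul, ← pow_add, Nat.mod_add_div]
  rw [hm]
  linear_combination (1 + PowerSeries.X : IwasawaAlgebra p) ^ (m % p ^ N) * hq

/-- The Amice residue of a natural power `(1+X)^m` is the indicator of the class of `m` in `ℤ/p^N`.
[cite: Washington1997, §7.1 Thm. 7.1] -/
theorem amice_onePlusX_pow (N m : ℕ) :
    amice p N ((1 + PowerSeries.X : IwasawaAlgebra p) ^ m) = Pi.single (m : ZMod (p ^ N)) 1 := by
  haveI : NeZero (p ^ N) := ⟨pow_ne_zero N hp.out.ne_zero⟩
  symm
  refine amice_eq_of_omega_dvd p N _ ?_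
  rw [Finset.sum_eq_single (m : ZMod (p ^ N))
      (fun x _ hx => by rw [Pi.single_eq_of_ne hx, map_zero, zero_mul]) (fun h => absurd (Finset.mem_univ _) h),
    Pi.single_eq_same, map_one, one_mul, ZMod.val_natCast]
  exact omega_dvd_onePlusX_pow_sub_pow_mod p N m

/-- `charEval ι u N ((1+X)^m) = u^m` for `u^{p^N} = 1`. [cite: Washington1997, §12.2 (p. 238)] -/
theorem charEval_onePlusX_pow {B : Type*} [CommRing B] (ι : ℤ_[p] →+* B) {u : B} {N : ℕ} (hu : u ^ p ^ N = 1)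
    (m : ℕ) : charEval p ι u N ((1 + PowerSeries.X : IwasawaAlgebra p) ^ m) = u ^ m := by
  haveI : NeZero (p ^ N) := ⟨pow_ne_zero N hp.out.ne_zero⟩
  rw [charEval_def, amice_onePlusX_pow, Finset.sum_eq_single (m : ZMod (p ^ N))
      (fun x _ hx => by rw [Pi.single_eq_of_ne hx, map_zero, zero_mul]) (fun h => absurd (Finset.mem_univ _) h),
    Pi.single_eq_same, map_one, one_mul, ZMod.val_natCast]
  conv_rhs => rw [← Nat.mod_add_div m (p ^ N), pow_add, pow_mul, hu, one_pow, mul_one]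

/-- ★ **`charEval` of a `p`-ADIC power**: for `x ∈ ℤ_p` and ANY natural `m ≡ x (mod p^N)` (`toZModPow N x = m`),
`charEval ι u N (binomialSeries ℤ_p x) = u^m` when `u^{p^N} = 1` (`(1+X)^x ≡ (1+X)^m (mod ω_N)`, tree
`exists_binomialSeries_sub_pow_eq`). [cite: Washington1997, §13.2] [cite: Washington1997, §7.1 Prop. 7.2] -/
theorem charEval_binomialSeries {B : Type*} [CommRing B] (ι : ℤ_[p] →+* B) {u : B} {N : ℕ} (hu : u ^ p ^ N = 1)
    {x : ℤ_[p]} {m : ℕ} (hx : PadicInt.toZModPow N x = (m : ZMod (p ^ N))) :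
    charEval p ι u N (PowerSeries.binomialSeries ℤ_[p] x) = u ^ m := by
  obtain ⟨q, hq⟩ := exists_binomialSeries_sub_pow_eq (p := p) hx
  rw [charEval_congr_of_omega_dvd_sub p ι u N ⟨q, hq⟩, charEval_onePlusX_pow p ι hu]

/-! ## §2 Level-`N` value maps: constancy on `ω_N`-classes and the eigen-law of a `p`-adic power -/

section CongruenceVal

variable {p}
variable {M B : Type*} [AddCommGroup M] [Module (IwasawaAlgebra p) M] [CommRing B] {u : B} {val : M →+ B}

/-- A level-`N` value map only sees `f mod ω_N`: `ω_N ∣ f − g ⇒ val (f • m) = val (g • m)` (granted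
`val ((1+X) • m) = u·val m` and `u^{p^N} = 1`). [cite: Washington1997, §7.1 Thm. 7.1] -/
theorem val_smul_congr_of_omega_dvd_sub (hT : ∀ m, val ((1 + PowerSeries.X : IwasawaAlgebra p) • m) = u * val m)
    {N : ℕ} (hu : u ^ p ^ N = 1) {f g : IwasawaAlgebra p}
    (h : ((1 + PowerSeries.X : IwasawaAlgebra p) ^ p ^ N - 1) ∣ f - g) (m : M) : val (f • m) = val (g • m) := by
  obtain ⟨q, hq⟩ := h
  rw [← sub_eq_zero, ← map_sub, ← sub_smul, hq, val_omega_mul_smul hT hu]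

/-- ★ **A `p`-ADIC power acts on level-`N` values by `u^m`**: `val ((binomialSeries ℤ_p x) • y) = u^m · val y` for
`x ∈ ℤ_p`, ANY natural `m ≡ x (mod p^N)`, granted `val ((1+X) • y) = u·val y` and `u^{p^N} = 1` — the eigen-law
`ℓ_χ(σ_𝔟·h) = χ(γ)^{-m}·ℓ_χ(h)` of a `p`-adic power `σ_𝔟 = γ^{κ(𝔟)}` read at a finite level.
[cite: Washington1997, §13.2] [cite: Kato2004Asterisque, Thm. 12.5 (1) (p. 221)] -/
theorem val_binomialSeries_smul (hT : ∀ m, val ((1 + PowerSeries.X : IwasawaAlgebra p) • m) = u * val m)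
    {N : ℕ} (hu : u ^ p ^ N = 1) {x : ℤ_[p]} {m : ℕ} (hx : PadicInt.toZModPow N x = (m : ZMod (p ^ N)))
    (y : M) : val (PowerSeries.binomialSeries ℤ_[p] x • y) = u ^ m * val y := by
  obtain ⟨q, hq⟩ := exists_binomialSeries_sub_pow_eq (p := p) hx
  rw [val_smul_congr_of_omega_dvd_sub hT hu ⟨q, hq⟩, val_onePlusX_pow_smul hT]

end CongruenceVal

end Literature.NumberTheory.EllipticCurves.IwasawaAlgebra

end
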